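import Summits.ResolutionOfSingularities.ResolutionOfSingularities.Theorems.RadicialJungCleanModelsF75cCurveStepNext
import HarnessLib

/-!
# [F-75c discharge, brick C3] One point blow-up of a GOOD configuration (regular, pairwise transversal curves):
# regularity and transversality persist, and no two strict transforms meet over the centre
# (The Stacks Project, Lemma 54.15.3 = Tag 0BI7 (1)(3); Lemma 54.15.6 = Tag 0BIC, proof ¶2)

Cell res-hironaka, D-0154 INPUTS discharger `res-inputs-p-f75c` for the named fact F-75c
`Literature.AlgebraicGeometry.Resolution.Stacks0BIC_embeddedResolutionCurvesInSurfaces_locus`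
(`--supports stmt-ResolutionOfSingularities-15917 --as helper`). Printed (Tag 0BIC ¶2): «If the maximum is `1` then, if
`p ∈ Y_1 ∩ … ∩ Y_r` for some `r > 2` …, then after blowing up `p` we see that `Y'_1, …, Y'_r` do not meet in points above
`p` and `m_{q_i}(Y'_i, E) = 1` where `Y'_i ∩ E = {q_i}`.» The bookkeeping used by the triple-point loop: under the
blowing up of a closed point `x` of a configuration all of whose members are regular and pairwise transversal,

* `isRegular_subscheme_strictTransform` — the strict transform of a regular member is regular (Tag 0BI7 (1): it is
  isomorphic to the member when `x` lies on it; off the centre the blowing up is a local isomorphism);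
* `sup_stalkIdeal_strictTransform_eq_maximalIdeal_of_ne` — off the exceptional fibre transversality persists;
* `strictTransform_inter_strictTransform_inter_fibre_eq_empty` — two distinct members through `x`, regular and
  transversal at `x`, have strict transforms which do not meet over `x` (Tag 0BI7 (3): the multiplicity would drop below
  `1`).

HONEST FRAMING: bookkeeping over tree theorems (`Stacks0BI7_intersectionMultiplicityDrop_holds`,
`length_strictTransform_eq_of_ne`); nothing here is a statement of [Hironaka2017]. AI-written; AI review is weaker than
expert review. References: The Stacks Project, Tags 0BI7, 0BIC [StacksProject].
-/

noncomputable section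

set_option linter.dupNamespace false -- mandated namespace of this single-conjunct summit

open CategoryTheory AlgebraicGeometry TopologicalSpace IsLocalRing

namespace Summit.ResolutionOfSingularities.ResolutionOfSingularities.Theorems

namespace F75c

open Literature.AlgebraicGeometry.Resolution
open Literature.AlgebraicGeometry.Resolution.CurveConfiguration
open Summit.ResolutionOfSingularities.ResolutionOfSingularities.Theorems.CP2008Prop44
open Scheme.IdealSheafData

universe u

variable {Y Y' : Scheme.{u}} [IsLocallyNoetherian Y] [IsLocallyNoetherian Y'] {x : Y} {hx : IsClosed ({x} : Set Y)}
  {π : Y' ⟶ Y}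

/-! ## Off the exceptional fibre -/

/-- Off the exceptional fibre the germ of the strict transform is the pushed-forward germ of the curve.
[cite: StacksProject, Tag 02OS] -/
theorem stalkIdeal_strictTransform_of_ne (hπ : IsBlowup π (vanishingIdeal ⟨{x}, hx⟩)) (C : Closeds Y)
    [IsIntegral (vanishingIdeal C).subscheme] (hdim : topologicalKrullDim (vanishingIdeal C).subscheme = 1)
    {q : Y'} (hq : π q ≠ x) :
    stalkIdeal (vanishingIdeal (⟨closure (π ⁻¹' ((C : Set Y) \ {x})), isClosed_closure⟩ : Closeds Y')) q =
      (stalkIdeal (vanishingIdeal C) (π q)).map (π.stalkMap q).hom := by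
  rw [← strictTransformIdeal_vanishingIdeal_eq hπ C hdim]
  refine stalkIdeal_strictTransformIdeal_of_notMem π _ _ ?_
  rw [Scheme.IdealSheafData.coe_support_vanishingIdeal]; exact hq

/-- **Off the exceptional fibre a regular point of the curve gives a regular point of the strict transform.**
[cite: StacksProject, Tag 02OS] -/
theorem not_mem_image_compl_regularLocus_strictTransform_of_ne (hπ : IsBlowup π (vanishingIdeal ⟨{x}, hx⟩))
    (C : Closeds Y) [IsIntegral (vanishingIdeal C).subscheme]
    (hdim : topologicalKrullDim (vanishingIdeal C).subscheme = 1) {q : Y'} (hq : π q ≠ x)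
    (hqC : π q ∈ (C : Set Y))
    (hreg : π q ∉ (vanishingIdeal C).subschemeι '' (Scheme.regularLocus (vanishingIdeal C).subscheme)ᶜ) :
    q ∉ (vanishingIdeal (⟨closure (π ⁻¹' ((C : Set Y) \ {x})), isClosed_closure⟩ : Closeds Y')).subschemeι ''
      (Scheme.regularLocus (vanishingIdeal
        (⟨closure (π ⁻¹' ((C : Set Y) \ {x})), isClosed_closure⟩ : Closeds Y')).subscheme)ᶜ := by
  have hqC' : q ∈ closure (π ⁻¹' ((C : Set Y) \ {x})) := (mem_closure_preimage_diff_iff π.continuous C hq).mpr hqC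
  rw [not_mem_image_compl_regularLocus_iff _ hqC', stalkIdeal_strictTransform_of_ne hπ C hdim hq]
  rw [not_mem_image_compl_regularLocus_iff _ hqC] at hreg
  haveI := hπ.isIso_stalkMap_of_not_mem_support (x' := q)
    (by rw [← SetLike.mem_coe, Scheme.IdealSheafData.coe_support_vanishingIdeal]; exact hq)
  let e : Y.presheaf.stalk (π q) ≃+* Y'.presheaf.stalk q := (asIso (π.stalkMap q)).commRingCatIsoToRingEquiv
  have he : (stalkIdeal (vanishingIdeal C) (π q)).map (π.stalkMap q).hom =
      (stalkIdeal (vanishingIdeal C) (π q)).map (e : Y.presheaf.stalk (π q) →+* Y'.presheaf.stalk q) := rfl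
  rw [he]
  exact IsRegularLocalRing.of_ringEquiv (Ideal.quotientEquiv _ _ e rfl)

/-- **Off the exceptional fibre transversality persists.** [cite: StacksProject, Tag 02OS] -/
theorem sup_stalkIdeal_strictTransform_eq_maximalIdeal_of_ne (hπ : IsBlowup π (vanishingIdeal ⟨{x}, hx⟩))
    (C C' : Closeds Y) [IsIntegral (vanishingIdeal C).subscheme]
    (hdimC : topologicalKrullDim (vanishingIdeal C).subscheme = 1) [IsIntegral (vanishingIdeal C').subscheme]
    (hdimC' : topologicalKrullDim (vanishingIdeal C').subscheme = 1) {q : Y'} (hq : π q ≠ x)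
    (htr : stalkIdeal (vanishingIdeal C) (π q) ⊔ stalkIdeal (vanishingIdeal C') (π q) =
      maximalIdeal (Y.presheaf.stalk (π q))) :
    stalkIdeal (vanishingIdeal (⟨closure (π ⁻¹' ((C : Set Y) \ {x})), isClosed_closure⟩ : Closeds Y')) q ⊔
        stalkIdeal (vanishingIdeal (⟨closure (π ⁻¹' ((C' : Set Y) \ {x})), isClosed_closure⟩ : Closeds Y')) q =
      maximalIdeal (Y'.presheaf.stalk q) := by
  rw [← length_stalk_quotient_sup_eq_one_iff, length_strictTransform_eq_of_ne hπ C C' hdimC hdimC' hq,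
    length_stalk_quotient_sup_eq_one_iff]
  exact htr

/-! ## Over the centre -/

/-- **The strict transform of a REGULAR member is regular** (Tag 0BI7 (1): isomorphic to the member if `x` lies on it;
a local isomorphism onto it otherwise). [cite: StacksProject, Tag 0BI7 (Lemma 54.15.3 (1))] -/
theorem isRegular_subscheme_strictTransform (hπ : IsBlowup π (vanishingIdeal ⟨{x}, hx⟩)) (C : Closeds Y)
    [IsIntegral (vanishingIdeal C).subscheme] (hdim : topologicalKrullDim (vanishingIdeal C).subscheme = 1)
    (hregC : Scheme.IsRegular (vanishingIdeal C).subscheme) :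
    Scheme.IsRegular (vanishingIdeal
      (⟨closure (π ⁻¹' ((C : Set Y) \ {x})), isClosed_closure⟩ : Closeds Y')).subscheme := by
  by_cases hxC : x ∈ (C : Set Y)
  · -- `x ∈ C`: the strict transform is isomorphic to `V(𝓘_C)`
    obtain ⟨c, hc⟩ := exists_subschemeι_eq C hxC
    have hxJ : x ∈ (vanishingIdeal (⟨{x}, hx⟩ : Closeds Y)).support := by
      rw [← SetLike.mem_coe, Scheme.IdealSheafData.coe_support_vanishingIdeal]; exact Set.mem_singleton x
    obtain ⟨⟨e, -⟩, -⟩ := Stacks0BI7_intersectionMultiplicityDrop_holds Y (vanishingIdeal C).subscheme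
      (vanishingIdeal C).subschemeι (vanishingIdeal ⟨{x}, hx⟩) x hx c hdim hc (hregC c) hxJ
      (subschemeι_genericPoint_notMem_singleton C hdim hx hc) Y' π hπ
    have hI : strictTransformIdeal π (vanishingIdeal ⟨{x}, hx⟩) (vanishingIdeal C).subschemeι.ker =
        vanishingIdeal ⟨closure (π ⁻¹' ((C : Set Y) \ {x})), isClosed_closure⟩ := by
      rw [Scheme.IdealSheafData.ker_subschemeι]; exact strictTransformIdeal_vanishingIdeal_eq hπ C hdim
    have h := Scheme.IsRegular.of_isOpenImmersion e.hom hregC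
    rwa [hI] at h
  · -- `x ∉ C`: every point of the strict transform is off the fibre
    refine isRegular_subscheme_of_forall_not_mem _ fun q hq => ?_
    have hqx : π q ≠ x := by
      intro h
      have hempty := closure_preimage_diff_inter_preimage_singleton_eq_empty π.continuous C hxC
      exact (Set.eq_empty_iff_forall_notMem.mp hempty) q ⟨hq, h⟩
    have hqC : π q ∈ (C : Set Y) := (mem_closure_preimage_diff_iff π.continuous C hqx).mp hq
    exact not_mem_image_compl_regularLocus_strictTransform_of_ne hπ C hdim hqx hqC
      (forall_not_mem_of_isRegular_subscheme C hregC (π q))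

/-- **Two distinct members through `x`, regular and transversal at `x`, have strict transforms which do not meet over
`x`** (Tag 0BI7 (3): at a common point over `x` the multiplicity would be `< m_x(C ∩ C') = 1`, but it is `≥ 1`).
[cite: StacksProject, Tag 0BI7 (Lemma 54.15.3 (3))] [cite: StacksProject, Tag 0BIC (Lemma 54.15.6, proof ¶2)] -/
theorem strictTransform_inter_strictTransform_inter_fibre_eq_empty (hπ : IsBlowup π (vanishingIdeal ⟨{x}, hx⟩))
    (C C' : Closeds Y) [IsIntegral (vanishingIdeal C).subscheme]
    (hdim : topologicalKrullDim (vanishingIdeal C).subscheme = 1) [IsIntegral (vanishingIdeal C').subscheme]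
    (hdim' : topologicalKrullDim (vanishingIdeal C').subscheme = 1) (hCC' : ¬ (C : Set Y) ⊆ C')
    (hxC : x ∈ (C : Set Y)) (hxC' : x ∈ (C' : Set Y))
    (hregx : x ∉ (vanishingIdeal C).subschemeι '' (Scheme.regularLocus (vanishingIdeal C).subscheme)ᶜ)
    (htr : stalkIdeal (vanishingIdeal C) x ⊔ stalkIdeal (vanishingIdeal C') x = maximalIdeal (Y.presheaf.stalk x)) :
    closure (π ⁻¹' ((C : Set Y) \ {x})) ∩ closure (π ⁻¹' ((C' : Set Y) \ {x})) ∩ π ⁻¹' {x} = ∅ := by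
  obtain ⟨c, hc⟩ := exists_subschemeι_eq C hxC
  have hregc : IsRegularLocalRing ((vanishingIdeal C).subscheme.presheaf.stalk c) := by
    by_contra h; exact hregx ⟨c, h, hc⟩
  obtain ⟨q₀, hq₀, hlt⟩ := exists_strictTransform_inter_fibre_eq_and_length_lt hπ C C' hdim hdim' hxC' hCC' hc hregc
  rw [(length_stalk_quotient_sup_eq_one_iff C C' x).mpr htr] at hlt
  rw [Set.eq_empty_iff_forall_notMem]
  rintro q ⟨⟨hqC, hqC'⟩, hqE⟩
  have hq : q = q₀ := by
    have : q ∈ closure (π ⁻¹' ((C : Set Y) \ {x})) ∩ π ⁻¹' {x} := ⟨hqC, hqE⟩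
    rw [hq₀] at this
    exact this
  subst hq
  have h2 := one_le_length_stalk_quotient_sup
    (⟨closure (π ⁻¹' ((C : Set Y) \ {x})), isClosed_closure⟩ : Closeds Y')
    (⟨closure (π ⁻¹' ((C' : Set Y) \ {x})), isClosed_closure⟩ : Closeds Y') hqC hqC'
  exact absurd (lt_of_le_of_lt h2 hlt) (lt_irrefl _)

end F75c

end Summit.ResolutionOfSingularities.ResolutionOfSingularities.Theorems

end
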